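/-
Copyright: statement-level skeleton of a published paper (lit-balaban cell, Phase-2 proof seat p13, gen 12). No proof
claims beyond what the kernel checks below.
-/
import Literature.MathematicalPhysics.QuantumFieldTheory.BalabanImbrieJaffe1984to88.BIJ88CumulantAllOrders5133
import Literature.Probability.LatticeModels.UrsellPartitionMoments

/-!
# `BalabanImbrieJaffe1984to88.BIJ88CumulantRegrouping5133` — T. Bałaban, J. Imbrie, A. Jaffe, *Effective action and cluster
properties of the abelian Higgs model*, Commun. Math. Phys. **114** (1988) 257–315 [BalabanImbrieJaffe1988], §5.13
p. 305 [PDF 49]: **`∂/∂s_Γ⟨H⟩_s` at every order IN THE PRINT'S BRACKET FORM, corrected** — the regrouping left open in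
`BIJ88CumulantAllOrders5133`:

  `∂Γ⟨H⟩(s) = Σ_{σ ∈ smallParts Γ} (−1)^{|σ|} ⟨Π_{B∈σ}[V_B;] H⟩_s`,

the sum over the set partitions `σ` of `Γ` into blocks of ONE OR TWO cubes of the joint truncated expectation
(Ursell function) of the block vertices `V_B` (`V_{{i}} = D_i(s,·) = Σ_{l≠i}s_l⟨□_iΦ,Δ□_lΦ⟩`, `V_{{i,l}} = ⟨□_iΦ,Δ□_lΦ⟩`;
tree sign `Δ = −Δ_print`) and of the observable `H`.  The print's display (*"The result is
⟨Πf(□_i)⟩_1 = Σ_Γ∫ds_Γ Σ_{pairings p of Γ}⟨Π_γ[⟨□_{i_γ}Φ,Δ□_{j_γ}Φ⟩;]Πf(□_i)⟩_{s_Γ}"*) keeps the `σ` with two-cube blocks only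
and fails at `|Γ| = 2` (`BIJ88PairingDisplay305.pairingDisplay_fails`, GAPS.md G-C2-24); this file proves the corrected
bracket form at every order.

Formalization.  `∂Γ⟨H⟩(s) = dexp Γ s` is the all-orders derivative family of `BIJ88CumulantAllOrders5133`
(`hasDerivAt_dexp`: its `s_j`-derivative is `∂(Γ∪j)⟨H⟩`, `dexp_empty`: `∂∅⟨H⟩ = ⟨H⟩_s`).  The joint truncation is
`LatticeModels.ursellOf` of the normalized BLOCK-FAMILY MOMENTS `fmoment s 𝔉 = ⟨Π_{B∈𝔉, B≠{H}} V_B · H^{[{H}∈𝔉]}⟩_s`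
(families `𝔉` of blocks of labels `Option I`, the observable being the block `{none}`), evaluated at the family
`{none} ∪ liftFam σ` — i.e. `⟨[V_{B₁};]⋯[V_{B_k};] H⟩_s` in the print's notation (the iterated brackets are the joint
truncated expectations, cf. p13 g6 `BIJ88TruncatedPair306`).  THE THEOREM `dexp_eq_sum_smallParts` (for `s` in the
unit cube, `H` bounded measurable):

  `dexp Γ s = Σ_{σ ∈ smallParts Γ} (−1)^{|σ|} · ursellOf (fmoment s) ({none} ∪ liftFam σ)`,

and its observable-free companion `ursell_pmoment_eq_sum_smallParts` (`Mᵀ_s(Γ) = Σ_σ (−1)^{|σ|} ⟨Π_{B∈σ}[V_B;]⟩ᵀ_s`, the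
derivatives of `log N_1`).  PROOF: the moments `M_s(P) = ⟨P_{P̃}H^{[H∈P]}⟩_s` of `BIJ88CumulantAllOrders5133` are
partition-structured, `M_s(P) = Σ_{σ ∈ setPartitions P}(Π_{B∈σ}w_B)·fmoment s σ` with block weights `w_{{H}} = 1`,
`w_B = −1` for a cube block of size ≤ 2, `w_B = 0` otherwise (`pmoment_eq_sum_setPartitions`: the block decomposition at
the label `H`, transport of set partitions along `some`, and linearity of the Gaussian integral over the finitely many
products of vertices, each integrable by its Gaussian growth); then the general theorem
`LatticeModels.ursellOf_sum_setPartitions` (truncation commutes with such superpositions) and the same regrouping.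

statement-level skeleton of published theorems with citation tags; proofs where landed; nothing here is a claim
about the Yang–Mills mass gap

PDF held: `paper:balaban1988-cmp114-bij-abelian-higgs-effective-action` (journal page = PDF page + 256).

CITATION HEADER (lean-in-tree rule).  lit-balaban cell (HOME `run/shared/lean/pub/lit-balaban/`), Phase 2, seat p13
gen 12; row **C2.Eq5.13.3-5.13.4** of `HOME/lit-balaban-r16/ROWS-C2-part2.md` (owner r16, referee ref-5; owner's flip
condition 2026-08-22T05:08Z *"the corrected form AT EVERY ORDER (cumulant expansion over set partitions of Γ into blocks
≤ 2) + the corrected walk form after IBP"* — this file completes the first clause; the post-IBP random-walk form is not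
addressed).  USED BY NAME, nothing restated: p13 g12 `BIJ88CumulantAllOrders5133.{pmoment, pmoment_empty,
pmoment_of_ne_empty, obs, obs_of_mem, obs_of_not_mem, dexp}`, `BIJ88PairingAllOrders5133.{smallParts, bvert, ppoly,
abs_bvert_le, continuous_bvert}`, `BIJ88SecondOrder5133.{num, integrable_growth_of_lower}`; p02
`BIJ88DirichletForms305.quadForm_interpForm_ge`; p13 g6 `isSymm_of_posDef`; `Literature.Probability.LatticeModels.{ursellOf,
setPartitions, sum_setPartitions_eq_sum_block, sum_setPartitions_map, ursellOf_sum_setPartitions (UrsellPartitionMoments)}`.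

## What is proved (0 `sorry`, standard axioms, no new `Prop` facts)

* §1 labels: `bweight` (`w_B`), `liftFam` (cube blocks ↦ label blocks), private plumbing (`bweight_map_some`,
  `prod_bweight_liftFam`, `insertNone_sdiff_none`, `none_block_notMem_liftFam`, …), **`regroup_lift`**,
  **`regroup_insertNone`** (a sum over the set partitions of `Γ.map some` / of `insertNone Γ` weighted by `Π w_B` is the
  signed sum over `smallParts Γ`);
* §2 block-family moments: `bprod`, `fobs`, `fmoment` (+ `_empty`, `bprod_liftFam`, `bprod_insert_none`, `fobs_liftFam`,
  `fobs_insert_none`, `fmoment_liftFam`, `fmoment_insert_none` — the moments of the `V_B`'s and `H`);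
* §3 analysis: `exists_prod_bvert_growth`, `integrable_prod_bvert`, **`num_ppoly_mul_eq_sum`** (linearity over
  `smallParts`), **`pmoment_eq_sum_setPartitions`**;
* §4 **`dexp_eq_sum_smallParts`**, `ursell_pmoment_eq_sum_smallParts`.
HONEST SCOPE.  Real fields, finite dimension, `H` bounded measurable, `s ∈ [0,1]^I`; the identification of the iterated
bracket `⟨[A₁;]⋯[A_k;]B⟩` with the joint Ursell function is by definition here (order two: `BIJ88TruncatedPair306`,
`BIJ88SecondOrder5133`); integration by parts / random walks NOT here.  NOT summit progress; NOT continuum; NOT Clay.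
-/

noncomputable section

namespace Literature.MathematicalPhysics.QuantumFieldTheory.BalabanImbrieJaffe1984to88.BIJ88CumulantRegrouping5133

open MeasureTheory Matrix Finset Function Filter
open scoped BigOperators Topology
open Literature.Probability.LatticeModels (ursellOf setPartitions IsSetPartition mem_setPartitions setPartitions_empty
  sum_setPartitions_eq_sum_block sum_setPartitions_map ursellOf_sum_setPartitions)
open Literature.MathematicalPhysics.QuantumFieldTheory.Balaban1983to89
open B2Eq228Conditioning (weight source)
open BIJ88DirichletForms305 (interpForm quadForm_interpForm_ge)
open BIJ88IntegrationByParts305 (isSymm_of_posDef)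
open BIJ88SecondOrder5133 (num integrable_growth_of_lower)
open BIJ88PairingAllOrders5133 (smallParts mem_smallParts bvert ppoly abs_bvert_le continuous_bvert)
open BIJ88CumulantAllOrders5133 (pmoment pmoment_empty pmoment_of_ne_empty obs obs_of_mem obs_of_not_mem dexp)

/-! ## §1  Labels, block weights, regrouping of weighted partition sums -/

section Labels

variable {I : Type} [DecidableEq I]

/-- Block weights on blocks of labels: the observable block `{none}` weighs `1`, a block of one or two cubes `−1`
(tree sign), any other block `0`. [cite: BalabanImbrieJaffe1988, §5.13 p.305] -/
def bweight (B : Finset (Option I)) : ℝ :=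
  if B = {none} then 1 else if none ∉ B ∧ B.card ≤ 2 then -1 else 0

/-- A family of cube blocks as a family of label blocks. [cite: BalabanImbrieJaffe1988, §5.13 p.305] -/
def liftFam (σ : Finset (Finset I)) : Finset (Finset (Option I)) :=
  σ.map (mapEmbedding Embedding.some).toEmbedding

omit [DecidableEq I] in
/-- [folklore] -/
private theorem none_notMem_map_some (B : Finset I) : none ∉ B.map Embedding.some := by
  simp

omit [DecidableEq I] in
/-- [folklore] -/
private theorem map_some_ne_none_block (B : Finset I) : B.map Embedding.some ≠ ({none} : Finset (Option I)) := by
  intro h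
  have : (none : Option I) ∈ B.map Embedding.some := h ▸ mem_singleton_self _
  exact none_notMem_map_some B this

/-- [folklore] -/
private theorem bweight_map_some (B : Finset I) :
    bweight (B.map Embedding.some) = if B.card ≤ 2 then -1 else 0 := by
  rw [bweight, if_neg (map_some_ne_none_block B), card_map]
  simp

omit [DecidableEq I] in
/-- [folklore] -/
private theorem mem_liftFam {σ : Finset (Finset I)} {B' : Finset (Option I)} :
    B' ∈ liftFam σ ↔ ∃ B ∈ σ, B.map Embedding.some = B' := by
  simp [liftFam]

omit [DecidableEq I] in
/-- The observable block is not a lifted cube block. [folklore] -/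
private theorem none_block_notMem_liftFam (σ : Finset (Finset I)) : ({none} : Finset (Option I)) ∉ liftFam σ := by
  intro h
  obtain ⟨B, -, hB⟩ := mem_liftFam.1 h
  exact map_some_ne_none_block B hB

/-- [folklore] -/
private theorem prod_bweight_liftFam (σ : Finset (Finset I)) :
    ∏ B ∈ liftFam σ, bweight B = if ∀ B ∈ σ, B.card ≤ 2 then (-1 : ℝ) ^ σ.card else 0 := by
  rw [liftFam, prod_map]
  simp only [RelEmbedding.coe_toEmbedding, mapEmbedding_apply, bweight_map_some]
  split_ifs with h
  · rw [prod_congr rfl fun B hB => if_pos (h B hB), prod_const]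
  · simp only [not_forall, not_le] at h
    obtain ⟨B, hB, hBc⟩ := h
    exact prod_eq_zero hB (if_neg (not_le.2 hBc))

/-- [folklore] -/
private theorem insertNone_sdiff_none (P : Finset I) :
    insertNone P \ {none} = P.map Embedding.some := by
  ext o
  cases o <;> simp

/-- **Regrouping, no observable**: a sum over the set partitions of `Γ.map some` weighted by `Π_B w_B` is the signed sum
over the small partitions of `Γ`. [cite: BalabanImbrieJaffe1988, §5.13 p.305] -/
theorem regroup_lift (Γ : Finset I) (g : Finset (Finset (Option I)) → ℝ) :
    ∑ σ ∈ setPartitions (Γ.map Embedding.some), (∏ B ∈ σ, bweight B) * g σ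
      = ∑ σ ∈ smallParts Γ, (-1 : ℝ) ^ σ.card * g (liftFam σ) := by
  rw [sum_setPartitions_map, smallParts, sum_filter]
  refine sum_congr rfl fun σ _ => ?_
  have hl : σ.map (mapEmbedding Embedding.some).toEmbedding = liftFam σ := rfl
  rw [hl, prod_bweight_liftFam]
  split_ifs <;> simp

/-- **Regrouping with the observable**: a sum over the set partitions of `insertNone Γ` weighted by `Π_B w_B` is the
signed sum over the small partitions of `Γ`, the observable forming its own block. [cite: BalabanImbrieJaffe1988, §5.13 p.305] -/
theorem regroup_insertNone (Γ : Finset I) (g : Finset (Finset (Option I)) → ℝ) :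
    ∑ σ ∈ setPartitions (insertNone Γ), (∏ B ∈ σ, bweight B) * g σ
      = ∑ σ ∈ smallParts Γ, (-1 : ℝ) ^ σ.card * g (insert {none} (liftFam σ)) := by
  rw [sum_setPartitions_eq_sum_block (none_mem_insertNone : none ∈ insertNone Γ)]
  have hmem : ({none} : Finset (Option I)) ∈ (insertNone Γ).powerset.filter (fun P => none ∈ P) :=
    mem_filter.2 ⟨mem_powerset.2 (singleton_subset_iff.2 none_mem_insertNone), mem_singleton_self _⟩
  rw [sum_eq_single_of_mem _ hmem]
  · rw [insertNone_sdiff_none, ← regroup_lift Γ (fun σ => g (insert {none} σ))]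
    refine sum_congr rfl fun κ hκ => ?_
    have hnot : ({none} : Finset (Option I)) ∉ κ := fun h => by
      have := (mem_setPartitions.1 hκ).subset h (mem_singleton_self none)
      simp at this
    rw [prod_insert hnot, bweight, if_pos rfl, one_mul]
  · intro P₀ hP₀ hne
    obtain ⟨-, hnP₀⟩ := mem_filter.1 hP₀
    have hw : bweight P₀ = 0 := by
      rw [bweight, if_neg hne, if_neg]
      exact fun h => h.1 hnP₀
    refine sum_eq_zero fun κ hκ => ?_
    have hnot : P₀ ∉ κ := (mem_setPartitions.1 hκ).notMem_of_sdiff ⟨none, hnP₀⟩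
    rw [prod_insert hnot, hw, zero_mul, zero_mul]

end Labels

/-! ## §2  Block-family moments: the moments of the block vertices and the observable -/

section Moments

variable {α I : Type} [Fintype α] [DecidableEq α] [Fintype I] [DecidableEq I]
  (blk : α → I) (Δ : Matrix α α ℝ)

/-- The product of the vertices of the cube blocks of a family of label blocks: `Π_{B∈𝔉, B≠{none}} V_{B̃}(s,Φ)`.
[cite: BalabanImbrieJaffe1988, §5.13 p.305] -/
def bprod (s : I → ℝ) (𝔉 : Finset (Finset (Option I))) (φ : α → ℝ) : ℝ :=
  ∏ B ∈ 𝔉.erase {none}, bvert blk Δ s (eraseNone B) φ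

omit [Fintype α] [DecidableEq α] [Fintype I] in
/-- The observable of a family: `H` if the block `{none}` is present, else `1`. [cite: BalabanImbrieJaffe1988, §5.13 p.305] -/
def fobs (H : (α → ℝ) → ℝ) (𝔉 : Finset (Finset (Option I))) (φ : α → ℝ) : ℝ :=
  if {none} ∈ 𝔉 then H φ else 1

/-- **Block-family moments** `fmoment s 𝔉 = ⟨Π_{B∈𝔉, B≠{none}}V_{B̃} · H^{[{none}∈𝔉]}⟩_s` (normalized; value `1` at `𝔉 = ∅`):
the moments of the random variables `V_B` (block vertices) and `H`, whose Ursell function at `{none} ∪ liftFam σ` is the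
joint truncated expectation `⟨[V_{B₁};]⋯[V_{B_k};]H⟩_s`. [cite: BalabanImbrieJaffe1988, §5.13 p.305] -/
def fmoment (f : α → ℝ) (H : (α → ℝ) → ℝ) (s : I → ℝ) (𝔉 : Finset (Finset (Option I))) : ℝ :=
  if 𝔉 = ∅ then 1 else num blk Δ f (fun φ => bprod blk Δ s 𝔉 φ * fobs H 𝔉 φ) s / num blk Δ f (fun _ => 1) s

/-- [cite: BalabanImbrieJaffe1988, §5.13 p.305] -/
theorem fmoment_empty (f : α → ℝ) (H : (α → ℝ) → ℝ) (s : I → ℝ) : fmoment blk Δ f H s ∅ = 1 := by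
  simp [fmoment]

/-- On a lifted family the product is over the cube blocks. [cite: BalabanImbrieJaffe1988, §5.13 p.305] -/
theorem bprod_liftFam (s : I → ℝ) (σ : Finset (Finset I)) (φ : α → ℝ) :
    bprod blk Δ s (liftFam σ) φ = ∏ B ∈ σ, bvert blk Δ s B φ := by
  rw [bprod, erase_eq_of_notMem (none_block_notMem_liftFam σ), liftFam, prod_map]
  simp only [RelEmbedding.coe_toEmbedding, mapEmbedding_apply, eraseNone_map_some]

/-- [cite: BalabanImbrieJaffe1988, §5.13 p.305] -/
theorem bprod_insert_none (s : I → ℝ) (σ : Finset (Finset I)) (φ : α → ℝ) :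
    bprod blk Δ s (insert {none} (liftFam σ)) φ = ∏ B ∈ σ, bvert blk Δ s B φ := by
  rw [← bprod_liftFam blk Δ s σ φ, bprod, bprod, erase_insert (none_block_notMem_liftFam σ),
    erase_eq_of_notMem (none_block_notMem_liftFam σ)]

omit [Fintype α] [DecidableEq α] [Fintype I] in
/-- [cite: BalabanImbrieJaffe1988, §5.13 p.305] -/
theorem fobs_liftFam (H : (α → ℝ) → ℝ) (σ : Finset (Finset I)) : fobs H (liftFam σ) = fun _ => 1 := by
  funext φ
  simp [fobs, none_block_notMem_liftFam σ]

omit [Fintype α] [DecidableEq α] [Fintype I] in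
/-- [cite: BalabanImbrieJaffe1988, §5.13 p.305] -/
theorem fobs_insert_none (H : (α → ℝ) → ℝ) (σ : Finset (Finset I)) : fobs H (insert {none} (liftFam σ)) = H := by
  funext φ
  simp [fobs]

/-- `fmoment s (liftFam σ) = ⟨Π_{B∈σ}V_B⟩_s` (`σ ≠ ∅`). [cite: BalabanImbrieJaffe1988, §5.13 p.305] -/
theorem fmoment_liftFam (f : α → ℝ) (H : (α → ℝ) → ℝ) (s : I → ℝ) {σ : Finset (Finset I)} (hσ : σ ≠ ∅) :
    fmoment blk Δ f H s (liftFam σ)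
      = num blk Δ f (fun φ => ∏ B ∈ σ, bvert blk Δ s B φ) s / num blk Δ f (fun _ => 1) s := by
  have hne : liftFam σ ≠ ∅ := by
    rw [liftFam, Ne, map_eq_empty]
    exact hσ
  rw [fmoment, if_neg hne, fobs_liftFam]
  simp only [bprod_liftFam, mul_one]

/-- `fmoment s ({none} ∪ liftFam σ) = ⟨Π_{B∈σ}V_B · H⟩_s`. [cite: BalabanImbrieJaffe1988, §5.13 p.305] -/
theorem fmoment_insert_none (f : α → ℝ) (H : (α → ℝ) → ℝ) (s : I → ℝ) (σ : Finset (Finset I)) :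
    fmoment blk Δ f H s (insert {none} (liftFam σ))
      = num blk Δ f (fun φ => (∏ B ∈ σ, bvert blk Δ s B φ) * H φ) s / num blk Δ f (fun _ => 1) s := by
  rw [fmoment, if_neg (insert_ne_empty _ _), fobs_insert_none]
  simp only [bprod_insert_none]

end Moments

/-! ## §3  Analysis: integrability of the products of vertices, linearity, the moments are partition-structured -/

section Analysis

variable {α I : Type} [Fintype α] [DecidableEq α] [Fintype I] [DecidableEq I] (blk : α → I)
  {Δ : Matrix α α ℝ} (hΔ : Δ.PosDef) {c C : ℝ} (hc : 0 < c)
  (hcΔ : ∀ v, c * (v ⬝ᵥ v) ≤ v ⬝ᵥ (Δ *ᵥ v)) (hCΔ : ∀ v, v ⬝ᵥ (Δ *ᵥ v) ≤ C * (v ⬝ᵥ v))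
  {s : I → ℝ} (hs : ∀ l, 0 ≤ s l ∧ s l ≤ 1) (f : α → ℝ)
  {G : (α → ℝ) → ℝ} (hGm : AEStronglyMeasurable G volume) {K₀ : ℝ} (hK : ∀ φ, ‖G φ‖ ≤ K₀)

omit [Fintype α] [DecidableEq α] [Fintype I] [DecidableEq I] in
/-- `(1 + Kx)ⁿ ≤ (1 + K/δ)ⁿ e^{nδx}` for `x, K ≥ 0`, `δ > 0`. [folklore] -/
private theorem one_add_mul_pow_le_exp {K δ x : ℝ} (hK : 0 ≤ K) (hδ : 0 < δ) (hx : 0 ≤ x) (n : ℕ) :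
    (1 + K * x) ^ n ≤ (1 + K / δ) ^ n * Real.exp (n * (δ * x)) := by
  have h2 : x ≤ Real.exp (δ * x) / δ := by
    rw [le_div_iff₀ hδ]
    have := Real.add_one_le_exp (δ * x)
    nlinarith
  have h3 : 1 + K * x ≤ (1 + K / δ) * Real.exp (δ * x) := by
    have h1 : (1 : ℝ) ≤ Real.exp (δ * x) := Real.one_le_exp (by positivity)
    have : K * x ≤ K / δ * Real.exp (δ * x) := by
      calc K * x ≤ K * (Real.exp (δ * x) / δ) := mul_le_mul_of_nonneg_left h2 hK
        _ = K / δ * Real.exp (δ * x) := by ring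
    linarith
  calc (1 + K * x) ^ n ≤ ((1 + K / δ) * Real.exp (δ * x)) ^ n := pow_le_pow_left₀ (by positivity) h3 n
    _ = (1 + K / δ) ^ n * Real.exp (n * (δ * x)) := by rw [mul_pow, ← Real.exp_nat_mul]

variable (Δ) in
include hcΔ hCΔ hs in
/-- **Gaussian growth of a product of vertices** on the cube: `|Π_{B∈τ}V_B(s,Φ)| ≤ K e^{ε‖Φ‖²}` for any `ε > 0`.
[cite: BalabanImbrieJaffe1988, §5.13 p.305] -/
theorem exists_prod_bvert_growth (hΔs : Δ.IsSymm) (τ : Finset (Finset I)) {ε : ℝ} (hε : 0 < ε) :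
    ∃ K : ℝ, ∀ φ : α → ℝ, |∏ B ∈ τ, bvert blk Δ s B φ| ≤ K * Real.exp (ε * (φ ⬝ᵥ φ)) := by
  set K₁ : ℝ := 2 * (Fintype.card I : ℝ) ^ 2 * |C - c| with hK₁
  have hK₁0 : 0 ≤ K₁ := by positivity
  set n : ℕ := τ.card with hn
  set δ : ℝ := ε / (n + 1) with hδ
  have hδ0 : 0 < δ := by positivity
  refine ⟨(1 + K₁ / δ) ^ n, fun φ => ?_⟩
  have hx : 0 ≤ φ ⬝ᵥ φ := Finset.sum_nonneg fun x _ => mul_self_nonneg (φ x)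
  have hs' : ∀ l, |s l| ≤ 2 := fun l => abs_le.2 ⟨by linarith [(hs l).1], by linarith [(hs l).2]⟩
  have h1 : |∏ B ∈ τ, bvert blk Δ s B φ| ≤ (1 + K₁ * (φ ⬝ᵥ φ)) ^ n := by
    rw [Finset.abs_prod]
    calc ∏ B ∈ τ, |bvert blk Δ s B φ| ≤ ∏ B ∈ τ, K₁ * (φ ⬝ᵥ φ) :=
          Finset.prod_le_prod (fun B _ => abs_nonneg _) (fun B _ => abs_bvert_le blk Δ hΔs hcΔ hCΔ hs' B φ)
      _ = (K₁ * (φ ⬝ᵥ φ)) ^ n := prod_const _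
      _ ≤ (1 + K₁ * (φ ⬝ᵥ φ)) ^ n := pow_le_pow_left₀ (by positivity) (by linarith) _
  have hpow := one_add_mul_pow_le_exp hK₁0 hδ0 hx n
  have hexp : Real.exp (n * (δ * (φ ⬝ᵥ φ))) ≤ Real.exp (ε * (φ ⬝ᵥ φ)) := by
    rw [Real.exp_le_exp]
    have hnδ : (n : ℝ) * δ ≤ ε := by
      rw [hδ, mul_div_assoc']
      rw [div_le_iff₀ (by positivity)]
      nlinarith
    nlinarith
  calc |∏ B ∈ τ, bvert blk Δ s B φ| ≤ (1 + K₁ * (φ ⬝ᵥ φ)) ^ n := h1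
    _ ≤ (1 + K₁ / δ) ^ n * Real.exp (n * (δ * (φ ⬝ᵥ φ))) := hpow
    _ ≤ (1 + K₁ / δ) ^ n * Real.exp (ε * (φ ⬝ᵥ φ)) := mul_le_mul_of_nonneg_left hexp (by positivity)

include hΔ hc hcΔ hCΔ hs hGm hK in
/-- Each product of vertices, times a bounded observable, is integrable against the interpolated Gaussian on the cube.
[cite: BalabanImbrieJaffe1988, §5.13 p.305] -/
theorem integrable_prod_bvert (τ : Finset (Finset I)) :
    Integrable fun φ : α → ℝ =>
      (∏ B ∈ τ, bvert blk Δ s B φ) * G φ * (weight (interpForm blk Δ s) φ * source f φ) := by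
  have hε : 2 * (c / 8) < c := by linarith
  obtain ⟨KK, hKK⟩ := exists_prod_bvert_growth blk Δ hcΔ hCΔ hs (isSymm_of_posDef hΔ) τ (by positivity : 0 < c / 8)
  have hm : AEStronglyMeasurable (fun φ : α → ℝ => (∏ B ∈ τ, bvert blk Δ s B φ) * G φ) volume :=
    (continuous_finsetProd _ fun B _ => continuous_bvert blk Δ s B).aestronglyMeasurable.mul hGm
  have hb : ∀ φ : α → ℝ, ‖(∏ B ∈ τ, bvert blk Δ s B φ) * G φ‖ ≤ KK * K₀ * Real.exp (c / 8 * (φ ⬝ᵥ φ)) := fun φ => by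
    rw [norm_mul, Real.norm_eq_abs]
    calc |∏ B ∈ τ, bvert blk Δ s B φ| * ‖G φ‖ ≤ KK * Real.exp (c / 8 * (φ ⬝ᵥ φ)) * K₀ :=
          mul_le_mul (hKK φ) (hK φ) (norm_nonneg _) ((abs_nonneg _).trans (hKK φ))
      _ = KK * K₀ * Real.exp (c / 8 * (φ ⬝ᵥ φ)) := by ring
  exact integrable_growth_of_lower (quadForm_interpForm_ge blk hcΔ hs) f hm hε hb

include hΔ hc hcΔ hCΔ hs hGm hK in
/-- **Linearity over the small partitions**: `N(P_Γ·G)(s) = Σ_{σ∈smallParts Γ}(−1)^{|σ|} N(Π_{B∈σ}V_B · G)(s)`.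
[cite: BalabanImbrieJaffe1988, §5.13 p.305] -/
theorem num_ppoly_mul_eq_sum (Γ : Finset I) :
    num blk Δ f (fun φ => ppoly blk Δ Γ s φ * G φ) s
      = ∑ σ ∈ smallParts Γ, (-1 : ℝ) ^ σ.card * num blk Δ f (fun φ => (∏ B ∈ σ, bvert blk Δ s B φ) * G φ) s := by
  simp only [num, ppoly, sum_mul]
  rw [integral_finsetSum _ fun σ _ => ?_]
  · refine sum_congr rfl fun σ _ => ?_
    rw [← integral_const_mul]
    refine integral_congr_ae (Eventually.of_forall fun φ => ?_)
    simp only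
    ring
  · have h := (integrable_prod_bvert blk hΔ hc hcΔ hCΔ hs f hGm hK σ).const_mul ((-1 : ℝ) ^ σ.card)
    refine h.congr (Eventually.of_forall fun φ => ?_)
    simp only
    ring

include hΔ hc hcΔ hCΔ hs hGm hK in
/-- **The moments `M_s` are partition-structured**: for every label set `P`,
`M_s(P) = Σ_{σ ∈ setPartitions P} (Π_{B∈σ} w_B) · fmoment s σ` (`G` the observable). [cite: BalabanImbrieJaffe1988, §5.13 p.305] -/
theorem pmoment_eq_sum_setPartitions (P : Finset (Option I)) :
    pmoment blk Δ f G s P = ∑ σ ∈ setPartitions P, (∏ B ∈ σ, bweight B) * fmoment blk Δ f G s σ := by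
  by_cases hn : none ∈ P
  · -- the observable is present: `P = insertNone P̃`
    have hP : P = insertNone (eraseNone P) := by
      rw [insertNone_eraseNone, insert_eq_of_mem hn]
    have hne : P ≠ ∅ := ne_empty_of_mem hn
    rw [hP, regroup_insertNone, ← hP, pmoment_of_ne_empty blk Δ f G s hne, obs_of_mem hn,
      num_ppoly_mul_eq_sum blk hΔ hc hcΔ hCΔ hs f hGm hK, sum_div]
    refine sum_congr rfl fun σ _ => ?_
    rw [fmoment_insert_none, mul_div_assoc]
  · -- no observable: `P = P̃.map some`
    by_cases hP0 : P = ∅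
    · subst hP0
      simp [setPartitions_empty, pmoment_empty, fmoment_empty]
    have hP : P = (eraseNone P).map Embedding.some := by
      rw [map_some_eraseNone, erase_eq_of_notMem hn]
    have hPt : eraseNone P ≠ ∅ := by
      intro h
      apply hP0
      rw [hP, h, map_empty]
    rw [hP, regroup_lift, ← hP, pmoment_of_ne_empty blk Δ f G s hP0, obs_of_not_mem hn,
      num_ppoly_mul_eq_sum blk hΔ hc hcΔ hCΔ hs f aestronglyMeasurable_const (K₀ := 1) (fun _ => by simp), sum_div]
    refine sum_congr rfl fun σ hσ => ?_
    have hσne : σ ≠ ∅ := by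
      intro h
      obtain ⟨i, hi⟩ := nonempty_iff_ne_empty.2 hPt
      obtain ⟨B, hB, -⟩ := (mem_smallParts.1 hσ).1.exists_mem hi
      rw [h] at hB
      simp at hB
    rw [fmoment_liftFam blk Δ f G s hσne, mul_div_assoc]
    simp only [mul_one]

end Analysis

/-! ## §4  The theorem: `∂Γ⟨H⟩` as the signed sum of joint truncations over the small partitions -/

section Main

variable {α I : Type} [Fintype α] [DecidableEq α] [Fintype I] [DecidableEq I] (blk : α → I)
  {Δ : Matrix α α ℝ} (hΔ : Δ.PosDef) {c C : ℝ} (hc : 0 < c)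
  (hcΔ : ∀ v, c * (v ⬝ᵥ v) ≤ v ⬝ᵥ (Δ *ᵥ v)) (hCΔ : ∀ v, v ⬝ᵥ (Δ *ᵥ v) ≤ C * (v ⬝ᵥ v))
  {s : I → ℝ} (hs : ∀ l, 0 ≤ s l ∧ s l ≤ 1) (f : α → ℝ)
  {H : (α → ℝ) → ℝ} (hHm : AEStronglyMeasurable H volume) {K₀ : ℝ} (hK : ∀ φ, ‖H φ‖ ≤ K₀)

include hΔ hc hcΔ hCΔ hs hHm hK in
/-- **`∂/∂s_Γ⟨H⟩_s` IN THE PRINT'S BRACKET FORM, CORRECTED, AT EVERY ORDER**: for `s ∈ [0,1]^I` and `H` bounded measurable,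

  `∂Γ⟨H⟩(s) = Σ_{σ ∈ smallParts Γ} (−1)^{|σ|} · ⟨Π_{B∈σ}[V_B;] H⟩_s`,

the joint truncation being `ursellOf (fmoment s) ({none} ∪ liftFam σ)`, the Ursell function of the moments of the block
vertices `V_B (B ∈ σ)` and `H` — the sum over the set partitions of `Γ` into blocks of one or two cubes (the print keeps the
pairings = two-cube blocks only, which fails at `|Γ| = 2`, G-C2-24).  With `BIJ88CumulantAllOrders5133.hasDerivAt_dexp` /
`dexp_empty`, this is the `Γ`-th `s`-derivative of `⟨H⟩_s` at every order. [cite: BalabanImbrieJaffe1988, §5.13 p.305] -/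
theorem dexp_eq_sum_smallParts (Γ : Finset I) :
    dexp blk Δ f H Γ s
      = ∑ σ ∈ smallParts Γ, (-1 : ℝ) ^ σ.card * ursellOf (fmoment blk Δ f H s) (insert {none} (liftFam σ)) := by
  have hM : pmoment blk Δ f H s = fun P => ∑ σ ∈ setPartitions P, (∏ B ∈ σ, bweight B) * fmoment blk Δ f H s σ := by
    funext P
    exact pmoment_eq_sum_setPartitions blk hΔ hc hcΔ hCΔ hs f hHm hK P
  rw [dexp, hM, ursellOf_sum_setPartitions bweight (fmoment blk Δ f H s) (fmoment_empty blk Δ f H s)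
    insertNone_nonempty, regroup_insertNone]

include hΔ hc hcΔ hCΔ hs hHm hK in
/-- **The observable-free companion** (derivatives of `log N_1`): for nonempty `Γ`,
`Mᵀ_s(Γ.map some) = Σ_{σ ∈ smallParts Γ} (−1)^{|σ|} ⟨Π_{B∈σ}[V_B;]⟩ᵀ_s` (joint truncation of the block vertices alone).
[cite: BalabanImbrieJaffe1988, §5.13 p.305] -/
theorem ursell_pmoment_eq_sum_smallParts {Γ : Finset I} (hΓ : Γ.Nonempty) :
    ursellOf (pmoment blk Δ f H s) (Γ.map Embedding.some)
      = ∑ σ ∈ smallParts Γ, (-1 : ℝ) ^ σ.card * ursellOf (fmoment blk Δ f H s) (liftFam σ) := by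
  have hM : pmoment blk Δ f H s = fun P => ∑ σ ∈ setPartitions P, (∏ B ∈ σ, bweight B) * fmoment blk Δ f H s σ := by
    funext P
    exact pmoment_eq_sum_setPartitions blk hΔ hc hcΔ hCΔ hs f hHm hK P
  rw [hM, ursellOf_sum_setPartitions bweight (fmoment blk Δ f H s) (fmoment_empty blk Δ f H s)
    (hΓ.map), regroup_lift]

end Main

end Literature.MathematicalPhysics.QuantumFieldTheory.BalabanImbrieJaffe1984to88.BIJ88CumulantRegrouping5133
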